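import Summits.RiemannHypothesis.RiemannHypothesis.Theses.RuelleBand
import Literature.NumberTheory.LFunctions.RiemannXiProofs
import Literature.NumberTheory.LFunctions.GeneralizedRH
import Mathlib.Analysis.Complex.TaylorSeries

/-!
# `CofiniteCriticalLine` (crux stmt-RiemannHypothesis-2064): eventual all-orders Laguerre positivity of `|ξ|²` is at least the whole crux

The crux of route RuelleBand, rank 5, is
`CofiniteCriticalLine := {s : ℂ | riemannZeta s = 0 ∧ 0 < s.re ∧ s.re < 1 ∧ s.re ≠ 1 / 2}.Finite`.
Refuter's standing-adversary output (cdisprove cycle 2), kernel-checked, statements inline, no new definitions.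

Crux idea `rate-band-collar-split` (`Cruxes/CofiniteCriticalLine/SketchIdeator3.lean`) proposes, as a "crude
sufficient condition" for its NEAR half `CollarMono`, the eventual form of the Csordas–Varga / Pólya (1927,
condition I′) positivity: `EventualLaguerreAllOrders T₂ := ∀ |t| ≥ T₂, ∀ n, 0 ≤ (d/dx)^{2n} |ξ(1/2 + x + it)|²`
at `x = 0`. This file proves that this condition implies the crux BY ITSELF — no rate, band or collar is
needed — so it is not a near-half statement at all:

* `cofinite_of_eventualLaguerreAllOrders` — body of `EventualLaguerreAllOrders T₂` restated verbatim ⟹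
  `CofiniteCriticalLine`. Proof: at an off-line zero `β + it`, `β > 1/2`, `|t| ≥ T₂`, the entire function
  `G(w) = ξ(1/2 + w + it) ξ(1/2 − w + it)` restricts on `ℝ` to `g(x) = |ξ(1/2 + x + it)|²`
  (`symmSq_ofReal`: `ξ(1/2 − x + it) = conj ξ(1/2 + x + it)` by `ξ(1 − s) = ξ(s)`, `ξ(s̄) = conj ξ(s)`), so its
  Taylor coefficients at `0` are the real numbers `g⁽ⁿ⁾(0)/n!` (`iteratedDeriv_ofReal_eq`), which vanish for odd
  `n` (`g` is even, Mathlib `iteratedDeriv_comp_neg`) and are `≥ 0` for even `n` (hypothesis); the Taylor series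
  of the entire `G` at the point `β − 1/2 > 0` (Mathlib `Complex.hasSum_taylorSeries_of_entire`) sums to
  `g(β − 1/2) = |ξ(β + it)|² = 0`, so every coefficient vanishes (`hasSum_zero_iff_of_nonneg`), `G ≡ 0`, and
  `ξ(3/2 + it) ξ(−1/2 + it) = 0` contradicts `ξ ≠ 0` off the open strip (`riemannXi_eq_zero_iff_holds`).
* `iteratedDeriv_ofReal_eq` — for an entire `G` with `G ∘ ofReal = ofReal ∘ g`: `G⁽ᵏ⁾(x) = g⁽ᵏ⁾(x)` on `ℝ`
  (general lemma; induction via `HasDerivAt.comp_ofReal` and the projections `reCLM`, `imCLM`).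

The converse (crux ⟹ eventual all-orders positivity, by factoring off the finitely many non-real zeros of
`Ξ` and the Laguerre–Pólya expansion of the remaining factor) is the Csordas–Varga theory and is not
formalised here; together they say `∃ T₂, EventualLaguerreAllOrders T₂ ⟺ crux`.
-/

noncomputable section

open Complex Set Filter Topology
open scoped ComplexConjugate Nat

namespace Summit.RiemannHypothesis.Cruxes.CofiniteCriticalLine.Negative

open Summit.RiemannHypothesis.RiemannHypothesis.Theses.RuelleBand
open Literature.NumberTheory.LFunctions

/-! ## Real restriction of an entire function: iterated derivatives -/

/-- If `G` is entire and real-valued on the real axis, `G ∘ ofReal = ofReal ∘ g`, then all iterated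
derivatives commute with the restriction: `G⁽ᵏ⁾(x) = g⁽ᵏ⁾(x)` for real `x`. [folklore] -/
theorem iteratedDeriv_ofReal_eq {G : ℂ → ℂ} {g : ℝ → ℝ} (hG : Differentiable ℂ G)
    (h : ∀ x : ℝ, G x = g x) (k : ℕ) (x : ℝ) :
    iteratedDeriv k G x = ((iteratedDeriv k g x : ℝ) : ℂ) := by
  induction k generalizing x with
  | zero => simpa using h x
  | succ k ih =>
    -- `G⁽ᵏ⁾` is entire
    have hGk : Differentiable ℂ (iteratedDeriv k G) := by
      rw [iteratedDeriv_eq_iterate]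
      have hA : AnalyticOnNhd ℂ G univ := fun z _ => hG.analyticAt z
      exact fun z => ((hA.iterated_deriv k) z (mem_univ z)).differentiableAt
    set c : ℂ := iteratedDeriv (k + 1) G x with hc
    have hd : HasDerivAt (iteratedDeriv k G) c (x : ℂ) := by
      rw [hc, iteratedDeriv_succ]
      exact (hGk x).hasDerivAt
    have hd' : HasDerivAt (fun y : ℝ => iteratedDeriv k G (y : ℂ)) c x := hd.comp_ofReal
    have hfun : (fun y : ℝ => iteratedDeriv k G (y : ℂ)) = fun y : ℝ => ((iteratedDeriv k g y : ℝ) : ℂ) :=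
      funext fun y => ih y
    rw [hfun] at hd'
    -- real and imaginary parts of the derivative
    have hre : HasDerivAt (iteratedDeriv k g) c.re x := by
      have h1 := Complex.reCLM.hasFDerivAt.comp_hasDerivAt x hd'
      have h2 : (⇑Complex.reCLM ∘ fun y : ℝ => ((iteratedDeriv k g y : ℝ) : ℂ)) = iteratedDeriv k g := by
        funext y; simp
      rw [h2, Complex.reCLM_apply] at h1
      convert h1 using 0
    have him0 : c.im = 0 := by
      have h1 := Complex.imCLM.hasFDerivAt.comp_hasDerivAt x hd'
      have h2 : (⇑Complex.imCLM ∘ fun y : ℝ => ((iteratedDeriv k g y : ℝ) : ℂ)) = fun _ => (0 : ℝ) := by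
        funext y; simp
      rw [h2, Complex.imCLM_apply] at h1
      have h3 : HasDerivAt (fun _ : ℝ => (0 : ℝ)) (0 : ℝ) x := hasDerivAt_const x 0
      have := h1.unique h3
      exact this
    have hre' : iteratedDeriv (k + 1) g x = c.re := by
      rw [iteratedDeriv_succ]
      exact hre.deriv
    apply Complex.ext
    · simp [hre']
    · simp [him0]

/-! ## The symmetric square `G(w) = ξ(1/2 + w + it) ξ(1/2 − w + it)` -/

/-- `ξ(1/2 − x + it) = conj ξ(1/2 + x + it)` for real `x, t` (`ξ(1 − s) = ξ(s)`, `ξ(s̄) = conj ξ(s)`).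
[folklore] -/
theorem riemannXi_reflect_conj (x t : ℝ) :
    riemannXi (1 / 2 - x + t * I) = conj (riemannXi (1 / 2 + x + t * I)) := by
  have h1 : (1 / 2 - x + t * I : ℂ) = 1 - conj (1 / 2 + x + t * I) := by
    apply Complex.ext <;> simp; ring
  rw [h1, riemannXi_one_sub, riemannXi_conj_holds]

/-- `|ξ|²` on the horizontal line as the restriction of the entire function
`G(w) = ξ(1/2 + w + it) ξ(1/2 − w + it)`. [folklore] -/
theorem symmSq_ofReal (t x : ℝ) :
    riemannXi (1 / 2 + x + t * I) * riemannXi (1 / 2 - x + t * I) =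
      ((‖riemannXi (1 / 2 + x + t * I)‖ ^ 2 : ℝ) : ℂ) := by
  rw [riemannXi_reflect_conj, Complex.mul_conj, Complex.normSq_eq_norm_sq]

/-- `|ξ(1/2 + x + it)|²` is even in `x`. [folklore] -/
theorem norm_sq_riemannXi_even (t x : ℝ) :
    ‖riemannXi (1 / 2 + ((-x : ℝ) : ℂ) + t * I)‖ ^ 2 = ‖riemannXi (1 / 2 + x + t * I)‖ ^ 2 := by
  have : (1 / 2 + ((-x : ℝ) : ℂ) + t * I : ℂ) = 1 / 2 - x + t * I := by push_cast; ring
  rw [this, riemannXi_reflect_conj, norm_conj]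

/-! ## `EventualLaguerreAllOrders T₂ → CofiniteCriticalLine` -/

/-- **The idea's `EventualLaguerreAllOrders T₂` (body verbatim) implies the crux BY ITSELF** (no rate, band
or collar needed). Proof: at an off-line zero `β + it` (`β > 1/2`, `|t| ≥ T₂`) the even entire function
`G(w) = ξ(1/2 + w + it)ξ(1/2 − w + it)` restricts to `g(x) = |ξ(1/2 + x + it)|²` on `ℝ`, so its Taylor
coefficients at `0` are `g⁽ⁿ⁾(0)/n!` — zero for odd `n` (evenness), `≥ 0` for even `n` (hypothesis); the Taylor
series at the point `β − 1/2 > 0` sums to `g(β − 1/2) = |ξ(β + it)|² = 0`, forcing every coefficient to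
vanish, so `G ≡ 0`, contradicting `ξ ≠ 0` on `re s ≥ 1`. So, like `FixedCollarMono (ε₀ ≥ 1/2)`, this
"sufficient condition for the near half" is at least the whole crux. [folklore] -/
theorem cofinite_of_eventualLaguerreAllOrders {T₂ : ℝ}
    (h : ∀ t : ℝ, T₂ ≤ |t| → ∀ n : ℕ,
      0 ≤ iteratedDeriv (2 * n) (fun x : ℝ => ‖riemannXi (1 / 2 + x + t * Complex.I)‖ ^ 2) 0) :
    CofiniteCriticalLine := by
  -- bookkeeping: it suffices to exclude zeros with `1/2 < re s < 1` of height `≥ T₂` (reflect the left half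
  -- by `s ↦ 1 - s`; zeros of bounded height are finitely many)
  suffices key : ∀ s : ℂ, riemannZeta s = 0 → 1 / 2 < s.re → s.re < 1 → T₂ ≤ |s.im| → False by
    refine (((isCompact_Icc (a := (0 : ℝ)) (b := 1)).reProdIm
      (isCompact_Icc (a := -T₂) (b := T₂))).inter_riemannZetaZeros_finite).subset ?_
    rintro s ⟨hz, h0, h1, hne⟩
    refine ⟨Complex.mem_reProdIm.2 ⟨⟨h0.le, h1.le⟩, abs_le.1 (le_of_not_gt fun hT => ?_)⟩, hz⟩
    rcases lt_or_gt_of_ne hne with hlt | hgt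
    · refine key (1 - s) (GeneralizedRH.riemannZeta_one_sub_eq_zero hz h0 h1) ?_ ?_ ?_
      · simp only [sub_re, one_re]; linarith
      · simp only [sub_re, one_re]; linarith
      · simp only [sub_im, one_im, zero_sub, abs_neg]; exact hT.le
    · exact key s hz hgt h1 hT.le
  intro s hz hs h1 hT
  set t : ℝ := s.im with ht
  set g : ℝ → ℝ := fun x : ℝ => ‖riemannXi (1 / 2 + x + t * Complex.I)‖ ^ 2 with hg
  set G : ℂ → ℂ := fun w : ℂ => riemannXi (1 / 2 + w + t * I) * riemannXi (1 / 2 - w + t * I) with hG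
  have hGg : ∀ x : ℝ, G x = g x := fun x => symmSq_ofReal t x
  have hGd : Differentiable ℂ G := by
    have h1 : Differentiable ℂ fun w : ℂ => riemannXi (1 / 2 + w + t * I) :=
      differentiable_riemannXi.comp ((differentiable_id.const_add _).add_const _)
    have h2 : Differentiable ℂ fun w : ℂ => riemannXi (1 / 2 - w + t * I) :=
      differentiable_riemannXi.comp ((differentiable_id.const_sub _).add_const _)
    exact h1.mul h2
  -- Taylor coefficients at 0 are real: `G⁽ⁿ⁾(0) = g⁽ⁿ⁾(0)`
  have hcoef : ∀ n : ℕ, iteratedDeriv n G 0 = ((iteratedDeriv n g 0 : ℝ) : ℂ) := by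
    intro n
    have := iteratedDeriv_ofReal_eq hGd hGg n 0
    simpa using this
  -- odd coefficients vanish (g is even)
  have heven : (fun x : ℝ => g (-x)) = g := by
    funext x
    simp only [hg]
    have := norm_sq_riemannXi_even t x
    push_cast at this ⊢
    exact this
  have hodd : ∀ n : ℕ, iteratedDeriv (2 * n + 1) g 0 = 0 := by
    intro n
    have h1 := iteratedDeriv_comp_neg (2 * n + 1) g 0
    rw [heven, neg_zero, smul_eq_mul, pow_succ, pow_mul] at h1
    norm_num at h1
    linarith
  -- all coefficients are ≥ 0
  have hnonneg : ∀ n : ℕ, 0 ≤ iteratedDeriv n g 0 := by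
    intro n
    rcases Nat.even_or_odd n with ⟨m, rfl⟩ | ⟨m, rfl⟩
    · have := h t hT m
      rw [two_mul] at this
      exact this
    · rw [hodd m]
  -- the zero: `g (β - 1/2) = 0`
  set a : ℝ := s.re - 1 / 2 with ha
  have ha0 : 0 < a := by rw [ha]; linarith
  have hsa : (1 / 2 + (a : ℂ) + t * I : ℂ) = s := by
    apply Complex.ext <;> simp [ha, ht]
  have hξs : riemannXi s = 0 := (riemannXi_eq_zero_iff_holds s).2 ⟨hz, by linarith, h1⟩
  have hga : g a = 0 := by simp only [hg, hsa, hξs, norm_zero]; norm_num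
  -- Taylor expansion of `G` at `0`, evaluated at `a`
  have htaylor := Complex.hasSum_taylorSeries_of_entire hGd 0 (a : ℂ)
  rw [hGg a, hga] at htaylor
  have hterm : ∀ n : ℕ, ((n ! : ℂ)⁻¹ • ((a : ℂ) - 0) ^ n • iteratedDeriv n G 0) =
      (((n ! : ℝ)⁻¹ * a ^ n * iteratedDeriv n g 0 : ℝ) : ℂ) := by
    intro n
    rw [hcoef n, sub_zero, smul_eq_mul, smul_eq_mul]
    push_cast
    ring
  have hsumR : HasSum (fun n : ℕ => (n ! : ℝ)⁻¹ * a ^ n * iteratedDeriv n g 0) 0 := by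
    have h2 : HasSum (fun n : ℕ => (((n ! : ℝ)⁻¹ * a ^ n * iteratedDeriv n g 0 : ℝ) : ℂ)) ((0 : ℝ) : ℂ) := by
      rw [Complex.ofReal_zero]
      exact htaylor.congr_fun fun n => (hterm n).symm
    exact Complex.hasSum_ofReal.1 h2
  have hterm0 : ∀ n : ℕ, (n ! : ℝ)⁻¹ * a ^ n * iteratedDeriv n g 0 = 0 := by
    have hnn : ∀ n : ℕ, 0 ≤ (n ! : ℝ)⁻¹ * a ^ n * iteratedDeriv n g 0 := fun n =>
      mul_nonneg (mul_nonneg (inv_nonneg.2 (Nat.cast_nonneg _)) (pow_nonneg ha0.le _)) (hnonneg n)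
    have := (hasSum_zero_iff_of_nonneg hnn).1 hsumR
    exact fun n => congrFun this n
  have hcoef0 : ∀ n : ℕ, iteratedDeriv n G 0 = 0 := by
    intro n
    have h3 := hterm0 n
    have hfac : (n ! : ℝ)⁻¹ * a ^ n ≠ 0 :=
      mul_ne_zero (inv_ne_zero (by exact_mod_cast (Nat.factorial_pos n).ne')) (pow_ne_zero _ ha0.ne')
    rcases mul_eq_zero.1 h3 with h4 | h4
    · exact absurd h4 hfac
    · rw [hcoef n, h4, Complex.ofReal_zero]
  -- hence `G ≡ 0`
  have hG0 : ∀ z : ℂ, G z = 0 := by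
    intro z
    have hz' := Complex.hasSum_taylorSeries_of_entire hGd 0 z
    simp only [hcoef0, smul_zero] at hz'
    exact (hz'.unique hasSum_zero)
  -- but `G 1 = ξ(3/2 + it) ξ(-1/2 + it) ≠ 0`
  have hG1 := hG0 1
  simp only [hG] at hG1
  rcases mul_eq_zero.1 hG1 with h5 | h5
  · have := ((riemannXi_eq_zero_iff_holds _).1 h5).2.2
    simp at this
    norm_num at this
  · have := ((riemannXi_eq_zero_iff_holds _).1 h5).2.1
    simp at this
    norm_num at this

end Summit.RiemannHypothesis.Cruxes.CofiniteCriticalLine.Negative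

end
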